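import Summits.CriticalPhenomena.PercolationContinuityZ3.Theorems.Transplant.KNCellsBoxProdZ2ConcG
import Summits.CriticalPhenomena.PercolationContinuityZ3.Theorems.Transplant.KNCellsBoxProdZ2ConcSchedule
import HarnessLib

/-!
# The (D) radius schedule as a `ConcRadiiG` (position-dependent at the root anchor): cube levels `n_Q`, own-cube levels `n_S`, the radii
# from the lead's recursion `Erad` / `Frad` (`E 0 = E₀` = root seed, `F (k+1) = E k + gap (E k)`, `E (k+1) = F (k+1) + gap' (F (k+1))`),
# and the proof of `ConcRadiiG.WF` — so that `cellGeomCG X C w₀ (concRadiiGOf C gap gap' E₀ L')` carries the six geometry records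

builds on p205010 (kernel theorem, internal audit signed; external expert review pending) — nothing in this file uses p205010.
Lane `prim-bschramm`, seat `prim-bschramm-p3` (orders I1/I2 of V56; D1 of the D-CHECKLIST); helper file
(`--supports stmt-CriticalPhenomena-4575 --as helper`).

Levels (seat analysis 14:24Z, HOME/prim-bschramm-p3/STATUS.md): the lag-1 layer gives the root `arr 0 = dep 0 = a₀ = 0`, so at anchor `0`
the planar generation decides the radius: `nQ 0 w = min ‖w‖₁ 2` (root seed `0`, children's cubes `1`, grandchildren's cubes `2`),
`nQ a w = a + 2` for `a ≥ 1`; the level of a cell's OWN cube seen from its stub anchor is `nS 0 0 = 0`, `nS 0 v = 1` (`v ≠ 0`), `nS a v = a + 1`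
(`a ≥ 1`).  Radii: `rQ a w = E (nQ a w)`, `rB a v δ = E (nQ a (v + δ))`, `rE a v δ = F (nS a v + 1) ⊓ E (nQ a (v + δ))`,
`ρ a v δ ℓ = E (nS a v) ⊓ rE a v δ` (further `⊓ E (nQ (a-1) v) ⊓ E (nQ a v)` on the base levels `ℓ ≤ 5r`), `rM a w = F (nQ a w) - L'`,
`rC a w = E (nQ a w + 3)`; the `⊓`-caps are vacuous in every realised configuration (`ρ_eq`, `rE_eq`) and make `WF` hold for ALL indices.
* `gen0`, `nQ`, `nS` (+ monotonicity / comparison lemmas); `concRadiiGOf C gap gap' E₀ L' : ConcRadiiG`; **`concRadiiGOf_WF`**;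
* realised values: `rE_eq` (`nQ a (v+δ) = nS a v + 1 ⇒ rE = F (nS a v + 1)`), `ρ_eq` (the profile is `E (nS a v)` when `nS a v ≤ nQ a (v+δ)`,
  `nS a v ≤ nQ (a-1) v`), `ρ_le` (always `≤ E (nS a v)`).
[cite: KozmaNitzan2024, §4 pp. 25–27 (Q_v, M_v, E_{v,x}, H^j_{v,x}) — the ℤ^d model has one cube size]
-/

noncomputable section

namespace Summit.CriticalPhenomena.PercolationContinuityZ3.Theorems

namespace Transplant

namespace BoxProdZ2

open Literature.Probability.Percolation Literature.Probability.LatticeModels SimpleGraph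
open Literature.Probability.Percolation.KozmaNitzan.Cells (oth oth_ne oth_oth sgOf sgOf_sign stepVec_apply_fst stepVec_apply_oth eq_oth_of_ne)

/-! ## §1 Levels -/

/-- The planar generation of a cell at the root anchor: `‖w‖₁` capped at `2`. [this work] -/
def gen0 (w : Site 2) : ℕ := min ((w 0).natAbs + (w 1).natAbs) 2

/-- `gen0 w ≤ 2`. [folklore] -/
theorem gen0_le (w : Site 2) : gen0 w ≤ 2 := min_le_right _ _

/-- `gen0 0 = 0`. [folklore] -/
@[simp] theorem gen0_zero : gen0 0 = 0 := by simp [gen0]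

/-- `gen0 w = 0` only for `w = 0`. [folklore] -/
theorem one_le_gen0 {w : Site 2} (hw : w ≠ 0) : 1 ≤ gen0 w := by
  unfold gen0
  by_contra h
  push Not at h
  have h0 : (w 0).natAbs = 0 := by omega
  have h1 : (w 1).natAbs = 0 := by omega
  apply hw
  funext i
  fin_cases i
  · simpa using Int.natAbs_eq_zero.1 h0
  · simpa using Int.natAbs_eq_zero.1 h1

/-- A unit step from the origin has generation `1`. [folklore] -/
theorem gen0_stepVec (δ : MDir) : gen0 (stepVec δ) = 1 := by
  unfold gen0
  have h1 : stepVec δ δ.1 = sgOf δ := stepVec_apply_fst δ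
  have h2 : stepVec δ (oth δ.1) = 0 := stepVec_apply_oth δ
  have hs : (sgOf δ).natAbs = 1 := by rcases sgOf_sign δ with h | h <;> simp [h]
  have key : (stepVec δ 0).natAbs + (stepVec δ 1).natAbs = 1 := by
    have hd : δ.1 = 0 ∨ δ.1 = 1 := by
      rcases δ with ⟨i, b⟩
      fin_cases i <;> simp
    rcases hd with hd | hd
    · have ho : oth δ.1 = 1 := by rw [hd]; rfl
      rw [hd] at h1; rw [ho] at h2
      rw [h1, h2, hs]; simp
    · have ho : oth δ.1 = 0 := by rw [hd]; rfl
      rw [hd] at h1; rw [ho] at h2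
      rw [h1, h2, hs]; simp
  rw [key]; rfl

/-- **Cube level** of `Q_a(w)`: planar generation at the root anchor, `a + 2` beyond. [this work] -/
def nQ (a : ℕ) (w : Site 2) : ℕ := if a = 0 then gen0 w else a + 2

/-- **Own-cube level** of `v` seen from its stub anchor `a`: `0` for the root, `1` for the root's children, `a + 1` beyond. [this work] -/
def nS (a : ℕ) (v : Site 2) : ℕ := if a = 0 then (if v = 0 then 0 else 1) else a + 1

/-- `nQ` is monotone in the anchor. [folklore] -/
theorem nQ_mono {a a' : ℕ} (h : a ≤ a') (w : Site 2) : nQ a w ≤ nQ a' w := by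
  unfold nQ
  have := gen0_le w
  split_ifs <;> omega

/-- `a ≤ nQ a w`. [folklore] -/
theorem le_nQ (a : ℕ) (w : Site 2) : a ≤ nQ a w := by
  unfold nQ; split_ifs <;> omega

/-- `nQ a' w ≤ nQ a v + 3` for `a' ≤ a + 1` (between-box inside the cell). [folklore] -/
theorem nQ_le_nQ_add_three {a a' : ℕ} (h : a' ≤ a + 1) (v w : Site 2) : nQ a' w ≤ nQ a v + 3 := by
  unfold nQ
  have := gen0_le w
  split_ifs <;> omega

/-- `nQ a (v + δ) ≤ nS a v + 1` (the next cube is at most one level above the own cube). [folklore] -/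
theorem nQ_add_le_nS_succ (a : ℕ) (v : Site 2) (δ : MDir) : nQ a (v + stepVec δ) ≤ nS a v + 1 := by
  unfold nQ nS
  by_cases ha : a = 0
  · simp only [ha, if_true]
    by_cases hv : v = 0
    · simp only [hv, if_true, zero_add, gen0_stepVec, le_refl]
    · simp only [hv, if_false]; exact gen0_le _
  · simp only [ha, if_false]; omega

/-- Members of `{a, a+1}`. [folklore] -/
theorem mem_pair {a a' : ℕ} (h : a' ∈ ({a, a + 1} : Finset ℕ)) : a' = a ∨ a' = a + 1 := by
  simpa [Finset.mem_insert, Finset.mem_singleton] using h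

/-! ## §2 The schedule -/

variable (C : PCells) (gap gap' : ℕ → ℕ) (E₀ L' : ℕ)

/-- **The (D) radius schedule** over the recursion `Erad` / `Frad`. [this work] -/
def concRadiiGOf : ConcRadiiG where
  rQ := fun a w => Erad gap gap' E₀ (nQ a w)
  rM := fun a w => Frad gap gap' E₀ (nQ a w) - L'
  rC := fun a w => Erad gap gap' E₀ (nQ a w + 3)
  rB := fun a v δ => Erad gap gap' E₀ (nQ a (v + stepVec δ))
  rE := fun a v δ => min (Frad gap gap' E₀ (nS a v + 1)) (Erad gap gap' E₀ (nQ a (v + stepVec δ)))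
  ρ := fun a v δ ℓ =>
    if ℓ ≤ 5 * (C.r : ℤ) then
      min (min (Erad gap gap' E₀ (nS a v)) (min (Frad gap gap' E₀ (nS a v + 1)) (Erad gap gap' E₀ (nQ a (v + stepVec δ)))))
        (min (Erad gap gap' E₀ (nQ (a - 1) v)) (Erad gap gap' E₀ (nQ a v)))
    else min (Erad gap gap' E₀ (nS a v)) (min (Frad gap gap' E₀ (nS a v + 1)) (Erad gap gap' E₀ (nQ a (v + stepVec δ))))

/-- `rQ a w = E (nQ a w)`. [folklore] -/
@[simp] theorem concRadiiGOf_rQ (a : ℕ) (w : Site 2) : (concRadiiGOf C gap gap' E₀ L').rQ a w = Erad gap gap' E₀ (nQ a w) := rfl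

/-- `rM a w = F (nQ a w) - L'`. [folklore] -/
@[simp] theorem concRadiiGOf_rM (a : ℕ) (w : Site 2) : (concRadiiGOf C gap gap' E₀ L').rM a w = Frad gap gap' E₀ (nQ a w) - L' := rfl

/-- `rB a v δ = E (nQ a (v + δ))`. [folklore] -/
@[simp] theorem concRadiiGOf_rB (a : ℕ) (v : Site 2) (δ : MDir) :
    (concRadiiGOf C gap gap' E₀ L').rB a v δ = Erad gap gap' E₀ (nQ a (v + stepVec δ)) := rfl

/-- `rE a v δ = F (nS a v + 1) ⊓ E (nQ a (v + δ))`. [folklore] -/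
theorem concRadiiGOf_rE (a : ℕ) (v : Site 2) (δ : MDir) :
    (concRadiiGOf C gap gap' E₀ L').rE a v δ = min (Frad gap gap' E₀ (nS a v + 1)) (Erad gap gap' E₀ (nQ a (v + stepVec δ))) := rfl

/-- **The schedule is well formed** (all eight order families, for all indices). [this work] -/
theorem concRadiiGOf_WF : (concRadiiGOf C gap gap' E₀ L').WF C where
  QC a a' x h :=
    Erad_mono gap gap' E₀ ((nQ_mono (by rcases mem_pair h with rfl | rfl <;> omega) x).trans (Nat.le_add_right _ _))
  BC a a' v δ h := by
    refine Erad_mono gap gap' E₀ (nQ_le_nQ_add_three ?_ v _)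
    rcases mem_pair h with rfl | rfl <;> omega
  BC' a a' v δ h := by
    refine Erad_mono gap gap' E₀ ?_
    have h1 : nQ a (v + stepVec δ) ≤ nQ a' (v + stepVec δ) := nQ_mono (by rcases mem_pair h with rfl | rfl <;> omega) _
    omega
  ρQ a a' v δ ℓ h hℓ := by
    change (if ℓ ≤ 5 * (C.r : ℤ) then _ else _) ≤ Erad gap gap' E₀ (nQ a v)
    rw [if_pos hℓ]
    rcases mem_pair h with rfl | rfl
    · exact (min_le_right _ _).trans (min_le_right _ _)
    · exact (min_le_right _ _).trans ((min_le_left _ _).trans (by simp))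
  ρE a v δ ℓ := by
    change (if ℓ ≤ 5 * (C.r : ℤ) then _ else _) ≤ min _ _
    split_ifs
    · exact (min_le_left _ _).trans (min_le_right _ _)
    · exact min_le_right _ _
  EB a v δ := min_le_right _ _
  EQ a v δ := min_le_right _ _
  ME a v δ := by
    change Frad gap gap' E₀ (nQ a (v + stepVec δ)) - L' ≤ min _ _
    refine le_min ((Nat.sub_le _ _).trans (Frad_mono gap gap' E₀ (nQ_add_le_nS_succ a v δ))) ?_
    exact (Nat.sub_le _ _).trans (Frad_le_Erad gap gap' E₀ _)

/-! ## §3 Realised values -/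

/-- The corridor profile never exceeds the own-cube radius `E (nS a v)`. [folklore] -/
theorem ρ_le (a : ℕ) (v : Site 2) (δ : MDir) (ℓ : ℤ) : (concRadiiGOf C gap gap' E₀ L').ρ a v δ ℓ ≤ Erad gap gap' E₀ (nS a v) := by
  change (if ℓ ≤ 5 * (C.r : ℤ) then _ else _) ≤ _
  split_ifs
  · exact (min_le_left _ _).trans (min_le_left _ _)
  · exact min_le_left _ _

/-- **Realised far-box radius**: when the next cube sits exactly one level above the own cube, `rE a v δ = F (nS a v + 1)`. [folklore] -/
theorem rE_eq {a : ℕ} {v : Site 2} {δ : MDir} (h : nQ a (v + stepVec δ) = nS a v + 1) :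
    (concRadiiGOf C gap gap' E₀ L').rE a v δ = Frad gap gap' E₀ (nS a v + 1) := by
  rw [concRadiiGOf_rE, h]
  exact min_eq_left (Frad_le_Erad gap gap' E₀ _)

/-- **Realised corridor profile**: if the own-cube level is at most the next cube's and the previous-anchor cube's level at `v`, the profile
is the own-cube radius `E (nS a v)` at every level. [folklore] -/
theorem ρ_eq {a : ℕ} {v : Site 2} {δ : MDir} (h1 : nS a v ≤ nQ a (v + stepVec δ)) (h2 : nS a v ≤ nQ (a - 1) v) (ℓ : ℤ) :
    (concRadiiGOf C gap gap' E₀ L').ρ a v δ ℓ = Erad gap gap' E₀ (nS a v) := by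
  have hA : Erad gap gap' E₀ (nS a v) ≤ min (Frad gap gap' E₀ (nS a v + 1)) (Erad gap gap' E₀ (nQ a (v + stepVec δ))) :=
    le_min (by simpa using Erad_pred_le_Frad gap gap' E₀ (nS a v + 1)) (Erad_mono gap gap' E₀ h1)
  have hB : Erad gap gap' E₀ (nS a v) ≤ min (Erad gap gap' E₀ (nQ (a - 1) v)) (Erad gap gap' E₀ (nQ a v)) := by
    refine le_min (Erad_mono gap gap' E₀ h2) (Erad_mono gap gap' E₀ ?_)
    exact h2.trans (nQ_mono (Nat.sub_le a 1) v)
  change (if ℓ ≤ 5 * (C.r : ℤ) then _ else _) = _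
  split_ifs
  · rw [min_eq_left hA, min_eq_left hB]
  · exact min_eq_left hA

/-! ## §4 The schedule with a THIN between-box (the one the kits use)

Correction (seat analysis 14:4xZ, HOME/prim-bschramm-p3/STATUS.md): the between-box `Btw_a(v, δ)` is revealed together with the next cube
`Q_a(v+δ)` by the probe `v → v+δ`, and its FRESH part is adjacent to that cube's first rows; since the corridor chain of that probe (KN
Lemma 12, `hreach`) lives in `Q_a(v+δ) ∪ H` at the cube radius `E (nQ a (v+δ))`, the entrances from the between-box must be deep, so the
between-box carries the FAR-BOX radius `rE a v δ = F (nS a v + 1) ⊓ …` (one gap below the cube), not the cube radius.  `concRadiiGB` is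
`concRadiiGOf` with `rB := rE`; the root probe (`hQ0`) then runs in the tube of radius `F 1` through `Btw_0(0,du) ∪ Q_0(child)`. -/

/-- **The (D) radius schedule with a thin between-box**: as `concRadiiGOf` but `rB = rE`. [this work] -/
def concRadiiGB : ConcRadiiG where
  rQ := (concRadiiGOf C gap gap' E₀ L').rQ
  rM := (concRadiiGOf C gap gap' E₀ L').rM
  rC := (concRadiiGOf C gap gap' E₀ L').rC
  rB := (concRadiiGOf C gap gap' E₀ L').rE
  rE := (concRadiiGOf C gap gap' E₀ L').rE
  ρ := (concRadiiGOf C gap gap' E₀ L').ρ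

/-- `rQ a w = E (nQ a w)`. [folklore] -/
@[simp] theorem concRadiiGB_rQ (a : ℕ) (w : Site 2) : (concRadiiGB C gap gap' E₀ L').rQ a w = Erad gap gap' E₀ (nQ a w) := rfl

/-- `rM a w = F (nQ a w) - L'`. [folklore] -/
@[simp] theorem concRadiiGB_rM (a : ℕ) (w : Site 2) : (concRadiiGB C gap gap' E₀ L').rM a w = Frad gap gap' E₀ (nQ a w) - L' := rfl

/-- `rB = rE`. [folklore] -/
@[simp] theorem concRadiiGB_rB (a : ℕ) (v : Site 2) (δ : MDir) :
    (concRadiiGB C gap gap' E₀ L').rB a v δ = (concRadiiGB C gap gap' E₀ L').rE a v δ := rfl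

/-- `rE a v δ = F (nS a v + 1) ⊓ E (nQ a (v + δ))`. [folklore] -/
theorem concRadiiGB_rE (a : ℕ) (v : Site 2) (δ : MDir) :
    (concRadiiGB C gap gap' E₀ L').rE a v δ = min (Frad gap gap' E₀ (nS a v + 1)) (Erad gap gap' E₀ (nQ a (v + stepVec δ))) := rfl

/-- The corridor profile of `concRadiiGB` is that of `concRadiiGOf`. [folklore] -/
theorem concRadiiGB_ρ : (concRadiiGB C gap gap' E₀ L').ρ = (concRadiiGOf C gap gap' E₀ L').ρ := rfl

/-- **The thin-between-box schedule is well formed.** [this work] -/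
theorem concRadiiGB_WF : (concRadiiGB C gap gap' E₀ L').WF C where
  QC := (concRadiiGOf_WF C gap gap' E₀ L').QC
  BC a a' v δ h := ((concRadiiGOf_WF C gap gap' E₀ L').EB a' v δ).trans ((concRadiiGOf_WF C gap gap' E₀ L').BC a a' v δ h)
  BC' a a' v δ h := ((concRadiiGOf_WF C gap gap' E₀ L').EB a v δ).trans ((concRadiiGOf_WF C gap gap' E₀ L').BC' a a' v δ h)
  ρQ := (concRadiiGOf_WF C gap gap' E₀ L').ρQ
  ρE := (concRadiiGOf_WF C gap gap' E₀ L').ρE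
  EB _ _ _ := le_rfl
  EQ := (concRadiiGOf_WF C gap gap' E₀ L').EQ
  ME := (concRadiiGOf_WF C gap gap' E₀ L').ME

/-- Realised far-box / between-box radius of `concRadiiGB`: `F (nS a v + 1)` when the next cube is one level up. [folklore] -/
theorem concRadiiGB_rE_eq {a : ℕ} {v : Site 2} {δ : MDir} (h : nQ a (v + stepVec δ) = nS a v + 1) :
    (concRadiiGB C gap gap' E₀ L').rE a v δ = Frad gap gap' E₀ (nS a v + 1) :=
  rE_eq C gap gap' E₀ L' h

/-- Realised corridor profile of `concRadiiGB`: `E (nS a v)`. [folklore] -/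
theorem concRadiiGB_ρ_eq {a : ℕ} {v : Site 2} {δ : MDir} (h1 : nS a v ≤ nQ a (v + stepVec δ)) (h2 : nS a v ≤ nQ (a - 1) v) (ℓ : ℤ) :
    (concRadiiGB C gap gap' E₀ L').ρ a v δ ℓ = Erad gap gap' E₀ (nS a v) :=
  ρ_eq C gap gap' E₀ L' h1 h2 ℓ

end BoxProdZ2

end Transplant

end Summit.CriticalPhenomena.PercolationContinuityZ3.Theorems

end
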